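import Summits.SmoothPoincare4.SmoothPoincare4.Theorems.EntropyRungSubcylindricalExistenceFlatChartRadial
import HarnessLib

/-!
# Radial gradient discrepancy and radial closeness in a flat chart
(crux stmt-SmoothPoincare4-10871 `EntropyRung.SubcylindricalExistence`, line
`fat-conical-core-avr-logsobolev`, helper stubs H-disc `helper_radialDiscrepancy` and H-close
`helper_radialCloseness` of lead c4's skeleton)

Let `g` be a smooth metric on a smooth `4`-manifold `M`, `p : M`, `φ = extChartAt (𝓡 4) p`
(`= chartAt _ p`, a chart of the maximal atlas), `y₀ = φ p`, and suppose `g` is Euclidean in the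
chart on `closedBall y₀ r ⊆ φ.target`. Let `Φ, ψ₀` be smooth positive functions on `M` with
`Φ ∘ φ⁻¹ = prof(‖· − y₀‖²)` on the open ball (`prof` smooth, positive on `[0, ∞)`) and
`ψ₀ ∘ φ⁻¹ = μ c' ‖· − y₀‖^{−(c'+1)}` on the closed annulus `ρ₁ ≤ ‖· − y₀‖ ≤ ρ₂`
(`0 < ρ₁ < ρ₂ < r`). On the open annulus `u = log(Φ/ψ₀)` reads
`u ∘ φ⁻¹ = h(‖· − y₀‖²)`, `h(s) = log prof(s) − log(μc') + ((c'+1)/2) log s`, so that, the metric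
being Euclidean there (`gradSq_of_flatOn`, germ-local),

* H-disc: `|∇u|²_g ∘ φ⁻¹ = 4 s h'(s)² = (2 s prof'(s)/prof(s) + c' + 1)² / s`, `s = ‖y − y₀‖²`;
* H-close: if `|2 s prof'/prof + (c'+1)| ≤ κ₁` on `[ρ₁², ρ₂²]` then `|∇u|²_g ≤ κ₁²/ρ²`, and if
  moreover `prof(ρ*²) = μ c' ρ*^{−(c'+1)}` for some `ρ* ∈ [ρ₁, ρ₂]`, then
  `e^{−κ₁ log(ρ₂/ρ₁)} ≤ Φ/ψ₀ ≤ e^{κ₁ log(ρ₂/ρ₁)}` on the annulus: in the variable `t = log ρ` the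
  function `H(t) = log prof(e^{2t}) + (c'+1) t − log(μc')` has `e^{H(log ρ)} = Φ/ψ₀`,
  `H' = 2 s prof'/prof + (c'+1) ∈ [−κ₁, κ₁]` on `[log ρ₁, log ρ₂]` and `H(log ρ*) = 0`, whence
  `|H| ≤ κ₁ log(ρ₂/ρ₁)` by the mean value theorem.

Everything is proved; no definition, no named fact.

References: B. O'Neill, *Semi-Riemannian geometry with applications to relativity* (1983),
Ch. 3, p. 85 and pp. 90–91 [ONeill1983].
-/

noncomputable section

open scoped Manifold ContDiff Topology RealInnerProductSpace
open Set Filter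
open Literature.Geometry.Lorentzian Literature.Geometry.Riemannian

-- the registered namespace `Summit.SmoothPoincare4.SmoothPoincare4.Theorems` repeats a component
set_option linter.dupNamespace false

namespace Summit.SmoothPoincare4.SmoothPoincare4.Theorems

namespace HelperRadialClosenessAux

section Euclidean

variable {E : Type*} [NormedAddCommGroup E] [InnerProductSpace ℝ E]

/-- The differential of `w ↦ h(‖w − y₀‖²)` at `z` for `h` differentiable at `‖z − y₀‖²`:
`2 h'(‖z − y₀‖²) ⟨z − y₀, ·⟩`. [folklore] -/
theorem hasFDerivAt_radial_of_hasDerivAt {h : ℝ → ℝ} {h' : ℝ} (y₀ z : E)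
    (hh : HasDerivAt h h' (‖z - y₀‖ ^ 2)) :
    HasFDerivAt (fun w : E ↦ h (‖w - y₀‖ ^ 2)) ((2 * h') • innerSL ℝ (z - y₀)) z := by
  have h1 : HasFDerivAt (fun w : E ↦ ‖w - y₀‖ ^ 2) ((2 : ℝ) • innerSL ℝ (z - y₀)) z := by
    refine (((hasFDerivAt_id z).sub_const y₀).norm_sq).congr_fderiv ?_
    ext v
    simp [two_smul]
  have h3 := hh.comp_hasFDerivAt z h1
  rw [smul_smul, mul_comm] at h3
  exact h3

end Euclidean

/-- `Σᵢ ((a ⟨v, ·⟩)(eᵢ))² = a² ‖v‖²` on `ℝ⁴`. [folklore] -/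
theorem sum_sq_smul_innerSL (a : ℝ) (v : EuclideanSpace ℝ (Fin 4)) :
    ∑ i, ((a • innerSL ℝ v) (EuclideanSpace.single i 1)) ^ 2 = a ^ 2 * ‖v‖ ^ 2 := by
  simp only [FunLike.coe_smul, Pi.smul_apply, innerSL_apply_apply,
    EuclideanSpace.inner_single_right, smul_eq_mul, conj_trivial, one_mul]
  rw [EuclideanSpace.real_norm_sq_eq, Finset.mul_sum]
  exact Finset.sum_congr rfl fun i _ ↦ by ring

/-- The derivative of the log-ratio profile `h(s) = log prof(s) − log(μc') + ((c'+1)/2) log s` at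
`s ≠ 0` with `prof s ≠ 0`: `h'(s) = prof'(s)/prof(s) + (c'+1)/(2s)`. [folklore] -/
theorem hasDerivAt_logProfile {prof : ℝ → ℝ} (hprof : ContDiff ℝ ∞ prof) (μ c' : ℝ) {s : ℝ}
    (hs : s ≠ 0) (hps : prof s ≠ 0) :
    HasDerivAt (fun s ↦ Real.log (prof s) - Real.log (μ * c') + (c' + 1) / 2 * Real.log s)
      (deriv prof s / prof s + (c' + 1) / 2 * s⁻¹) s :=
  ((((hprof.differentiable (by simp)) s).hasDerivAt.log hps).sub_const _).add
    ((Real.hasDerivAt_log hs).const_mul _)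

/-- `e^{2 log u} = u²` for `u > 0`. [folklore] -/
theorem exp_two_mul_log {u : ℝ} (hu : 0 < u) : Real.exp (2 * Real.log u) = u ^ 2 := by
  rw [← Real.rpow_two, Real.rpow_def_of_pos hu]
  congr 1
  ring

/-- The log-profile in the variable `t = log ρ`, `H(t) = log prof(e^{2t}) + (c'+1) t − log(μc')`,
exponentiates to the ratio: `e^{H(log ρ)} = prof(ρ²) / (μ c' ρ^{−(c'+1)})`, `ρ > 0`. [folklore] -/
theorem exp_logProfile {prof : ℝ → ℝ} (hpos : ∀ s, 0 ≤ s → 0 < prof s) {μ c' : ℝ} (hμ : 0 < μ)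
    (hc : 0 < c') {ρ : ℝ} (hρ : 0 < ρ) :
    Real.exp (Real.log (prof (Real.exp (2 * Real.log ρ))) + (c' + 1) * Real.log ρ
        - Real.log (μ * c')) = prof (ρ ^ 2) / (μ * (c' * ρ ^ (-(c' + 1)))) := by
  have hρc : ρ ^ (c' + 1) ≠ 0 := (Real.rpow_pos_of_pos hρ _).ne'
  rw [exp_two_mul_log hρ, Real.exp_sub, Real.exp_add, Real.exp_log (hpos _ (sq_nonneg ρ)),
    Real.exp_log (mul_pos hμ hc), mul_comm (c' + 1) (Real.log ρ), ← Real.rpow_def_of_pos hρ,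
    Real.rpow_neg hρ.le]
  field_simp

/-- **Radial closeness by the mean value theorem in `t = log ρ`**: if the log-slope
`2 s prof'/prof` is `κ₁`-close to `−(c'+1)` on `[ρ₁², ρ₂²]` and `prof(ρ*²) = μ c' ρ*^{−(c'+1)}` at
some `ρ* ∈ [ρ₁, ρ₂]`, then `e^{−κ₁ log(ρ₂/ρ₁)} ≤ prof(ρ²)/(μ c' ρ^{−(c'+1)}) ≤ e^{κ₁ log(ρ₂/ρ₁)}`
for `ρ ∈ [ρ₁, ρ₂]`. [folklore] -/
theorem ratio_bounds {prof : ℝ → ℝ} (hprof : ContDiff ℝ ∞ prof) (hpos : ∀ s, 0 ≤ s → 0 < prof s)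
    {μ c' ρ₁ ρ₂ ρstar κ₁ : ℝ} (hμ : 0 < μ) (hc : 0 < c') (hρ₁ : 0 < ρ₁)
    (h₁ : ρ₁ ≤ ρstar) (h₂ : ρstar ≤ ρ₂) (hκ₁ : 0 ≤ κ₁)
    (hQ : ∀ s, ρ₁ ^ 2 ≤ s → s ≤ ρ₂ ^ 2 → |2 * s * deriv prof s / prof s + (c' + 1)| ≤ κ₁)
    (hmatch : prof (ρstar ^ 2) = μ * (c' * ρstar ^ (-(c' + 1)))) {ρ : ℝ} (hρ₁ρ : ρ₁ ≤ ρ)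
    (hρρ₂ : ρ ≤ ρ₂) :
    Real.exp (-(κ₁ * Real.log (ρ₂ / ρ₁))) ≤ prof (ρ ^ 2) / (μ * (c' * ρ ^ (-(c' + 1)))) ∧
      prof (ρ ^ 2) / (μ * (c' * ρ ^ (-(c' + 1)))) ≤ Real.exp (κ₁ * Real.log (ρ₂ / ρ₁)) := by
  set H : ℝ → ℝ := fun t ↦ Real.log (prof (Real.exp (2 * t))) + (c' + 1) * t - Real.log (μ * c')
    with hH
  have hρ : 0 < ρ := hρ₁.trans_le hρ₁ρ
  have hρs : 0 < ρstar := hρ₁.trans_le h₁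
  have hρ₂ : 0 < ρ₂ := hρs.trans_le h₂
  -- the derivative of `H`
  have hder : ∀ t, HasDerivAt H
      (2 * Real.exp (2 * t) * deriv prof (Real.exp (2 * t)) / prof (Real.exp (2 * t)) + (c' + 1))
      t := by
    intro t
    have he : HasDerivAt (fun t ↦ Real.exp (2 * t)) (Real.exp (2 * t) * 2) t := by
      simpa using ((hasDerivAt_id' t).const_mul (2 : ℝ)).exp
    have hp : HasDerivAt (fun t ↦ prof (Real.exp (2 * t)))
        (deriv prof (Real.exp (2 * t)) * (Real.exp (2 * t) * 2)) t :=
      ((hprof.differentiable (by simp)) _).hasDerivAt.comp t he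
    have hl := hp.log (hpos _ (Real.exp_pos _).le).ne'
    have hlin : HasDerivAt (fun t ↦ (c' + 1) * t) ((c' + 1) * 1) t :=
      (hasDerivAt_id' t).const_mul _
    refine ((hl.add hlin).sub_const (Real.log (μ * c'))).congr_deriv ?_
    ring
  -- its bound on `[log ρ₁, log ρ₂]`
  have hbound : ∀ t ∈ Set.Icc (Real.log ρ₁) (Real.log ρ₂),
      ‖2 * Real.exp (2 * t) * deriv prof (Real.exp (2 * t)) / prof (Real.exp (2 * t))
        + (c' + 1)‖ ≤ κ₁ := by
    intro t ht
    rw [Real.norm_eq_abs]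
    apply hQ
    · rw [← exp_two_mul_log hρ₁]
      exact Real.exp_le_exp.2 (by linarith [ht.1])
    · rw [← exp_two_mul_log hρ₂]
      exact Real.exp_le_exp.2 (by linarith [ht.2])
  have hts : Real.log ρstar ∈ Set.Icc (Real.log ρ₁) (Real.log ρ₂) :=
    ⟨Real.log_le_log hρ₁ h₁, Real.log_le_log hρs h₂⟩
  have htρ : Real.log ρ ∈ Set.Icc (Real.log ρ₁) (Real.log ρ₂) :=
    ⟨Real.log_le_log hρ₁ hρ₁ρ, Real.log_le_log hρ hρρ₂⟩
  have hmvt := (convex_Icc (Real.log ρ₁) (Real.log ρ₂)).norm_image_sub_le_of_norm_hasDerivWithin_le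
    (fun t _ ↦ (hder t).hasDerivWithinAt) hbound hts htρ
  -- `e^{H(log u)}` is the ratio, and `H(log ρ*) = 0`
  have hexpH : ∀ u, 0 < u →
      Real.exp (H (Real.log u)) = prof (u ^ 2) / (μ * (c' * u ^ (-(c' + 1)))) :=
    fun u hu ↦ exp_logProfile hpos hμ hc hu
  have hH0 : H (Real.log ρstar) = 0 := by
    have h := hexpH ρstar hρs
    rw [hmatch, div_self (mul_pos hμ (mul_pos hc (Real.rpow_pos_of_pos hρs _))).ne'] at h
    exact (Real.exp_eq_one_iff _).1 h
  rw [hH0, sub_zero] at hmvt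
  have hdist : ‖Real.log ρ - Real.log ρstar‖ ≤ Real.log (ρ₂ / ρ₁) := by
    rw [Real.norm_eq_abs, Real.log_div hρ₂.ne' hρ₁.ne']
    have := hts.1; have := hts.2; have := htρ.1; have := htρ.2
    exact abs_le.2 ⟨by linarith, by linarith⟩
  have hK : |H (Real.log ρ)| ≤ κ₁ * Real.log (ρ₂ / ρ₁) :=
    (Real.norm_eq_abs _ ▸ hmvt).trans (mul_le_mul_of_nonneg_left hdist hκ₁)
  rw [← hexpH ρ hρ]
  exact ⟨Real.exp_le_exp.2 (abs_le.1 hK).1, Real.exp_le_exp.2 (abs_le.1 hK).2⟩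

section Chart

variable {M : Type*} [TopologicalSpace M] [ChartedSpace (EuclideanSpace ℝ (Fin 4)) M]
  [IsManifold (𝓡 4) ∞ M]

/-- **The radial gradient discrepancy in a flat chart of the maximal atlas** (workhorse): for `g`
Euclidean in `e` on `closedBall y₀ r`, `Φ ∘ e⁻¹ = prof(‖· − y₀‖²)` on `ball y₀ r` and
`ψ₀ ∘ e⁻¹ = μ c' ‖· − y₀‖^{−(c'+1)}` on the closed annulus `ρ₁ ≤ ‖· − y₀‖ ≤ ρ₂` (`ρ₂ < r`), at
`e⁻¹ y` with `ρ₁ < ‖y − y₀‖ < ρ₂`: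
`|∇ log(Φ/ψ₀)|²_g = (2 s prof'(s)/prof(s) + c' + 1)²/s`, `s = ‖y − y₀‖²` (the Euclidean gradient
of `h(‖· − y₀‖²)`, `h = log prof − log(μc') + ((c'+1)/2) log`, by germ-locality of `|∇·|²_g` on
the open annulus). [cite: ONeill1983, Ch. 3, p. 85 and pp. 90–91] -/
theorem gradSq_logRatio_of_flat
    (g : PseudoRiemannianMetric (𝓡 4) ∞ (EuclideanSpace ℝ (Fin 4)) (TangentSpace (𝓡 4) : M → Type _))
    {e : OpenPartialHomeomorph M (EuclideanSpace ℝ (Fin 4))}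
    (he : e ∈ IsManifold.maximalAtlas (𝓡 4) ∞ M) {y₀ : EuclideanSpace ℝ (Fin 4)} {r : ℝ}
    {Φ ψ₀ : M → ℝ} {prof : ℝ → ℝ} {μ c' ρ₁ ρ₂ : ℝ}
    (hB : Metric.closedBall y₀ r ⊆ e.target)
    (hflat : ∀ y ∈ Metric.closedBall y₀ r, ∀ X W : EuclideanSpace ℝ (Fin 4),
      g.val (e.symm y) (mfderiv 𝓘(ℝ, EuclideanSpace ℝ (Fin 4)) (𝓡 4) e.symm y X)
        (mfderiv 𝓘(ℝ, EuclideanSpace ℝ (Fin 4)) (𝓡 4) e.symm y W) = ⟪X, W⟫)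
    (hprof : ContDiff ℝ ∞ prof) (hpos : ∀ s, 0 ≤ s → 0 < prof s) (hμ : 0 < μ) (hc : 0 < c')
    (hρ₁ : 0 < ρ₁) (hρ₂r : ρ₂ < r)
    (hΦpos : ∀ x, 0 < Φ x) (hψpos : ∀ x, 0 < ψ₀ x)
    (hΦs : ContMDiff (𝓡 4) 𝓘(ℝ, ℝ) ∞ Φ) (hψs : ContMDiff (𝓡 4) 𝓘(ℝ, ℝ) ∞ ψ₀)
    (hΦ : ∀ y ∈ Metric.ball y₀ r, Φ (e.symm y) = prof (‖y - y₀‖ ^ 2))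
    (hψ : ∀ y : EuclideanSpace ℝ (Fin 4), ρ₁ ≤ ‖y - y₀‖ → ‖y - y₀‖ ≤ ρ₂ →
        ψ₀ (e.symm y) = μ * (c' * ‖y - y₀‖ ^ (-(c' + 1))))
    {y : EuclideanSpace ℝ (Fin 4)} (hy₁ : ρ₁ < ‖y - y₀‖) (hy₂ : ‖y - y₀‖ < ρ₂) :
    g.gradSq (fun x ↦ Real.log (Φ x / ψ₀ x)) (e.symm y) =
      (2 * ‖y - y₀‖ ^ 2 * deriv prof (‖y - y₀‖ ^ 2) / prof (‖y - y₀‖ ^ 2) + c' + 1) ^ 2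
        / ‖y - y₀‖ ^ 2 := by
  -- the open annulus `A`, an open subset of the flat ball
  set A : Set (EuclideanSpace ℝ (Fin 4)) := (fun z ↦ ‖z - y₀‖) ⁻¹' Set.Ioo ρ₁ ρ₂ with hA
  have hAo : IsOpen A := isOpen_Ioo.preimage (continuous_id.sub continuous_const).norm
  have hAball : A ⊆ Metric.ball y₀ r := fun z hz ↦ by
    rw [Metric.mem_ball, dist_eq_norm]
    exact hz.2.trans hρ₂r
  have hAe : A ⊆ e.target := hAball.trans (Metric.ball_subset_closedBall.trans hB)
  have hyA : y ∈ A := ⟨hy₁, hy₂⟩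
  have hflat' : ∀ z ∈ A, ∀ v w, g.val (e.symm z) v w =
      (euclideanMetric (EuclideanSpace ℝ (Fin 4))).val z
        (mfderiv (𝓡 4) (𝓡 4) e (e.symm z) v) (mfderiv (𝓡 4) (𝓡 4) e (e.symm z) w) :=
    fun z hz v w ↦ HelperFlatChartRadialAux.flat_pushforward g he (hAe hz)
      (hflat z (Metric.ball_subset_closedBall (hAball hz))) v w
  -- `log(Φ/ψ₀)` is smooth
  have hF : ContMDiffAt (𝓡 4) 𝓘(ℝ, ℝ) ∞ (fun x ↦ Real.log (Φ x / ψ₀ x)) (e.symm y) := by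
    have h1 : ContMDiffAt (𝓡 4) 𝓘(ℝ, ℝ) ∞ (Φ / ψ₀) (e.symm y) :=
      (hΦs _).div₀ (hψs _) (hψpos _).ne'
    have h2 : ContDiffAt ℝ ∞ Real.log ((Φ / ψ₀) (e.symm y)) :=
      Real.contDiffAt_log.2 (div_pos (hΦpos _) (hψpos _)).ne'
    exact h2.comp_contMDiffAt h1
  rw [gradSq_of_flatOn g he hAo hAe hflat' hyA (hF.mdifferentiableAt (by simp))]
  -- the representative of `log(Φ/ψ₀)` near `y` is `h(‖· − y₀‖²)`
  have hs : 0 < ‖y - y₀‖ ^ 2 := pow_pos (hρ₁.trans hy₁) 2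
  have hps : prof (‖y - y₀‖ ^ 2) ≠ 0 := (hpos _ hs.le).ne'
  have hev : (fun x ↦ Real.log (Φ x / ψ₀ x)) ∘ e.symm =ᶠ[𝓝 y] fun w ↦
      Real.log (prof (‖w - y₀‖ ^ 2)) - Real.log (μ * c') + (c' + 1) / 2 * Real.log (‖w - y₀‖ ^ 2) := by
    filter_upwards [hAo.mem_nhds hyA] with z hz
    have hzpos : 0 < ‖z - y₀‖ := hρ₁.trans hz.1
    have hzr : 0 < ‖z - y₀‖ ^ (-(c' + 1)) := Real.rpow_pos_of_pos hzpos _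
    simp only [Function.comp_apply]
    rw [hΦ z (hAball hz), hψ z hz.1.le hz.2.le,
      Real.log_div (hpos _ (sq_nonneg _)).ne' (mul_pos hμ (mul_pos hc hzr)).ne',
      Real.log_mul hμ.ne' (mul_pos hc hzr).ne', Real.log_mul hc.ne' hzr.ne', Real.log_rpow hzpos,
      Real.log_mul hμ.ne' hc.ne', Real.log_pow]
    push_cast
    ring
  rw [hev.fderiv_eq, (hasFDerivAt_radial_of_hasDerivAt y₀ y
    (hasDerivAt_logProfile hprof μ c' hs.ne' hps)).fderiv, sum_sq_smul_innerSL]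
  have hρ0 : ‖y - y₀‖ ≠ 0 := (hρ₁.trans hy₁).ne'
  field_simp
  ring

end Chart

end HelperRadialClosenessAux

/-- **H-disc — the radial gradient discrepancy in a flat chart** (registered helper stub
`helper_radialDiscrepancy` of line `fat-conical-core-avr-logsobolev`). For `Φ ∘ φ⁻¹ = prof(‖y − φ p‖²)`
on the chart ball and `ψ₀ ∘ φ⁻¹ = μ c' ‖y − φ p‖^{−(c'+1)}` on a closed annulus inside it (both
smooth positive on `M`, `g` Euclidean in the chart `φ = extChartAt (𝓡 4) p`): on the open annulus,
`|∇ log(Φ/ψ₀)|²_g ∘ φ⁻¹ = (Q(s) + c' + 1)²/s`, `Q = 2 s prof'/prof`, `s = ‖y − φ p‖²`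
(`HelperRadialClosenessAux.gradSq_logRatio_of_flat` for the chart `chartAt _ p = extChartAt (𝓡 4) p`
of the maximal atlas). The hypotheses `0 < r` and `ρ₁ < ρ₂` are not used.
[cite: ONeill1983, Ch. 3, p. 85 and pp. 90–91] -/
theorem helper_radialDiscrepancy :
    ∀ (M : Type) [TopologicalSpace M] [T2Space M] [SecondCountableTopology M]
      [ChartedSpace (EuclideanSpace ℝ (Fin 4)) M] [IsManifold (𝓡 4) ∞ M]
      (g : PseudoRiemannianMetric (𝓡 4) ∞ (EuclideanSpace ℝ (Fin 4)) (TangentSpace (𝓡 4) : M → Type _))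
      [g.HasLeviCivita] (p : M) (r : ℝ) (Φ ψ₀ : M → ℝ) (prof : ℝ → ℝ) (μ c' ρ₁ ρ₂ : ℝ),
      0 < r →
      (Metric.closedBall (extChartAt (𝓡 4) p p) r ⊆ (extChartAt (𝓡 4) p).target ∧
        ∀ y ∈ Metric.closedBall (extChartAt (𝓡 4) p p) r, ∀ X W : EuclideanSpace ℝ (Fin 4),
          g.val ((extChartAt (𝓡 4) p).symm y)
            (mfderiv 𝓘(ℝ, EuclideanSpace ℝ (Fin 4)) (𝓡 4) (extChartAt (𝓡 4) p).symm y X)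
            (mfderiv 𝓘(ℝ, EuclideanSpace ℝ (Fin 4)) (𝓡 4) (extChartAt (𝓡 4) p).symm y W) = ⟪X, W⟫) →
      ContDiff ℝ ∞ prof → (∀ s, 0 ≤ s → 0 < prof s) → 0 < μ → 0 < c' → 0 < ρ₁ → ρ₁ < ρ₂ → ρ₂ < r →
      (∀ x, 0 < Φ x) → (∀ x, 0 < ψ₀ x) →
      ContMDiff (𝓡 4) 𝓘(ℝ, ℝ) ∞ Φ → ContMDiff (𝓡 4) 𝓘(ℝ, ℝ) ∞ ψ₀ →
      (∀ y ∈ Metric.ball (extChartAt (𝓡 4) p p) r,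
        Φ ((extChartAt (𝓡 4) p).symm y) = prof (‖y - extChartAt (𝓡 4) p p‖ ^ 2)) →
      (∀ y : EuclideanSpace ℝ (Fin 4), ρ₁ ≤ ‖y - extChartAt (𝓡 4) p p‖ → ‖y - extChartAt (𝓡 4) p p‖ ≤ ρ₂ →
        ψ₀ ((extChartAt (𝓡 4) p).symm y) = μ * (c' * ‖y - extChartAt (𝓡 4) p p‖ ^ (-(c' + 1)))) →
      ∀ y : EuclideanSpace ℝ (Fin 4), ρ₁ < ‖y - extChartAt (𝓡 4) p p‖ → ‖y - extChartAt (𝓡 4) p p‖ < ρ₂ →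
        g.gradSq (fun x ↦ Real.log (Φ x / ψ₀ x)) ((extChartAt (𝓡 4) p).symm y) =
          (2 * ‖y - extChartAt (𝓡 4) p p‖ ^ 2 * deriv prof (‖y - extChartAt (𝓡 4) p p‖ ^ 2)
              / prof (‖y - extChartAt (𝓡 4) p p‖ ^ 2) + c' + 1) ^ 2
            / ‖y - extChartAt (𝓡 4) p p‖ ^ 2 := by
  intro M _ _ _ _ _ g _ p r Φ ψ₀ prof μ c' ρ₁ ρ₂ _ hflat hprof hpos hμ hc hρ₁ _ hρ₂r hΦpos hψpos hΦs hψs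
    hΦ hψ y hy₁ hy₂
  have hφ := HelperFlatChartRadialAux.extChartAt_eq_chartAt (M := M) p
  rw [hφ] at hflat hΦ hψ hy₁ hy₂ ⊢
  simp only [OpenPartialHomeomorph.coe_toPartialEquiv, OpenPartialHomeomorph.coe_toPartialEquiv_symm]
    at hflat hΦ hψ hy₁ hy₂ ⊢
  exact HelperRadialClosenessAux.gradSq_logRatio_of_flat g (IsManifold.chart_mem_maximalAtlas p)
    hflat.1 hflat.2 hprof hpos hμ hc hρ₁ hρ₂r hΦpos hψpos hΦs hψs hΦ hψ hy₁ hy₂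

/-- **H-close — radial closeness in a flat chart** (registered helper stub `helper_radialCloseness`
of line `fat-conical-core-avr-logsobolev`). With the data of `helper_radialDiscrepancy`, if the
log-slope `Q(s) = 2 s prof'(s)/prof(s)` is `κ₁`-close to `−(c'+1)` on `[ρ₁², ρ₂²]` and
`prof(ρ*²) = μ c' ρ*^{−(c'+1)}` at one radius `ρ* ∈ [ρ₁, ρ₂]`, then on the open annulus
`|∇ log(Φ/ψ₀)|²_g ≤ κ₁²/ρ²` (from H-disc) and `e^{−κ₁ log(ρ₂/ρ₁)} ≤ Φ/ψ₀ ≤ e^{κ₁ log(ρ₂/ρ₁)}`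
(mean value theorem in `t = log ρ`, `HelperRadialClosenessAux.ratio_bounds`).
[cite: ONeill1983, Ch. 3, p. 85 and pp. 90–91] -/
theorem helper_radialCloseness :
    ∀ (M : Type) [TopologicalSpace M] [T2Space M] [SecondCountableTopology M]
      [ChartedSpace (EuclideanSpace ℝ (Fin 4)) M] [IsManifold (𝓡 4) ∞ M]
      (g : PseudoRiemannianMetric (𝓡 4) ∞ (EuclideanSpace ℝ (Fin 4)) (TangentSpace (𝓡 4) : M → Type _))
      [g.HasLeviCivita] (p : M) (r : ℝ) (Φ ψ₀ : M → ℝ) (prof : ℝ → ℝ) (μ c' ρ₁ ρ₂ ρstar κ₁ : ℝ),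
      0 < r →
      (Metric.closedBall (extChartAt (𝓡 4) p p) r ⊆ (extChartAt (𝓡 4) p).target ∧
        ∀ y ∈ Metric.closedBall (extChartAt (𝓡 4) p p) r, ∀ X W : EuclideanSpace ℝ (Fin 4),
          g.val ((extChartAt (𝓡 4) p).symm y)
            (mfderiv 𝓘(ℝ, EuclideanSpace ℝ (Fin 4)) (𝓡 4) (extChartAt (𝓡 4) p).symm y X)
            (mfderiv 𝓘(ℝ, EuclideanSpace ℝ (Fin 4)) (𝓡 4) (extChartAt (𝓡 4) p).symm y W) = ⟪X, W⟫) →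
      ContDiff ℝ ∞ prof → (∀ s, 0 ≤ s → 0 < prof s) → 0 < μ → 0 < c' → 0 < ρ₁ → ρ₁ < ρ₂ → ρ₂ < r →
      ρ₁ ≤ ρstar → ρstar ≤ ρ₂ → 0 ≤ κ₁ →
      (∀ x, 0 < Φ x) → (∀ x, 0 < ψ₀ x) →
      ContMDiff (𝓡 4) 𝓘(ℝ, ℝ) ∞ Φ → ContMDiff (𝓡 4) 𝓘(ℝ, ℝ) ∞ ψ₀ →
      (∀ y ∈ Metric.ball (extChartAt (𝓡 4) p p) r,
        Φ ((extChartAt (𝓡 4) p).symm y) = prof (‖y - extChartAt (𝓡 4) p p‖ ^ 2)) →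
      (∀ y : EuclideanSpace ℝ (Fin 4), ρ₁ ≤ ‖y - extChartAt (𝓡 4) p p‖ → ‖y - extChartAt (𝓡 4) p p‖ ≤ ρ₂ →
        ψ₀ ((extChartAt (𝓡 4) p).symm y) = μ * (c' * ‖y - extChartAt (𝓡 4) p p‖ ^ (-(c' + 1)))) →
      (∀ s, ρ₁ ^ 2 ≤ s → s ≤ ρ₂ ^ 2 → |2 * s * deriv prof s / prof s + (c' + 1)| ≤ κ₁) →
      prof (ρstar ^ 2) = μ * (c' * ρstar ^ (-(c' + 1))) →
      ∀ y : EuclideanSpace ℝ (Fin 4), ρ₁ < ‖y - extChartAt (𝓡 4) p p‖ → ‖y - extChartAt (𝓡 4) p p‖ < ρ₂ →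
        g.gradSq (fun x ↦ Real.log (Φ x / ψ₀ x)) ((extChartAt (𝓡 4) p).symm y) ≤
            κ₁ ^ 2 / ‖y - extChartAt (𝓡 4) p p‖ ^ 2 ∧
        Real.exp (-(κ₁ * Real.log (ρ₂ / ρ₁))) ≤
            Φ ((extChartAt (𝓡 4) p).symm y) / ψ₀ ((extChartAt (𝓡 4) p).symm y) ∧
        Φ ((extChartAt (𝓡 4) p).symm y) / ψ₀ ((extChartAt (𝓡 4) p).symm y) ≤
            Real.exp (κ₁ * Real.log (ρ₂ / ρ₁)) := by
  intro M _ _ _ _ _ g _ p r Φ ψ₀ prof μ c' ρ₁ ρ₂ ρstar κ₁ hr hflat hprof hpos hμ hc hρ₁ hρ₁₂ hρ₂r h₁ h₂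
    hκ₁ hΦpos hψpos hΦs hψs hΦ hψ hQ hmatch y hy₁ hy₂
  refine ⟨?_, ?_⟩
  · rw [helper_radialDiscrepancy M g p r Φ ψ₀ prof μ c' ρ₁ ρ₂ hr hflat hprof hpos hμ hc hρ₁ hρ₁₂ hρ₂r
      hΦpos hψpos hΦs hψs hΦ hψ y hy₁ hy₂]
    have hρ : 0 < ‖y - extChartAt (𝓡 4) p p‖ := hρ₁.trans hy₁
    refine div_le_div_of_nonneg_right ?_ (sq_nonneg _)
    have hb := hQ (‖y - extChartAt (𝓡 4) p p‖ ^ 2) (pow_le_pow_left₀ hρ₁.le hy₁.le 2)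
      (pow_le_pow_left₀ hρ.le hy₂.le 2)
    rw [add_assoc]
    exact sq_le_sq' (abs_le.1 hb).1 (abs_le.1 hb).2
  · have hball : y ∈ Metric.ball (extChartAt (𝓡 4) p p) r := by
      rw [Metric.mem_ball, dist_eq_norm]
      exact hy₂.trans hρ₂r
    rw [hΦ y hball, hψ y hy₁.le hy₂.le]
    exact HelperRadialClosenessAux.ratio_bounds hprof hpos hμ hc hρ₁ h₁ h₂ hκ₁ hQ hmatch hy₁.le hy₂.le

end Summit.SmoothPoincare4.SmoothPoincare4.Theorems

end
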